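import Literature.MathematicalPhysics.QuantumLattice.SublatticeSelectiveInteractions
import HarnessLib

/-!
# The three-band (Emery) `CuO₂` model by `2 × 2` decoration of `ℤ²`: a typed superlattice one-band family,
# its dummy-free periodic variational class, and the coupling calculus in `(t_pd, t_pp, ε_d, ε_p, U_d, U_p)`

Topic `Literature/MathematicalPhysics/QuantumLattice` (family `hubbard`; `ℤ²`). Sequel of
`SublatticeSelectiveInteractions` (coset-selective hopping / on-site atoms and their views) and
`SuperlatticeCellEnergyFamilies` (`viewFamily`, `infCellEnergyOn`, concavity / box / Lipschitz / trial caps).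
Written for stage S2 (CERTIFIER-FAMILIES) of the Hubbard material-oracle programme, item (iv) of the execution
plan (HORIZON-BREAK §12.2: «multi-band: after (i); three-band Emery … not before 09-16») and the router's
`3BE` words: the three-band Emery model has no object in the one-band CAR framework over `ℤ²` (one orbital per
site). Here it is realised by DECORATION: on the `2 × 2` superlattice of `ℤ²`, copper `d` orbitals sit on
`(0,0) + 2ℤ²`, oxygen `p_x` on `(1,0) + 2ℤ²`, `p_y` on `(0,1) + 2ℤ²` (the Lieb lattice), and the fourth coset
`(1,1) + 2ℤ²` is a DUMMY sublattice that no term touches and that the variational class pins EMPTY. All terms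
are the atoms of the prequel; the model is a `viewFamily`, so the whole superlattice calculus applies verbatim.

* §1 geometry: `liebPeriods = (2,2)`-periods, the coset labels `cuSite, oxSite, oySite, dummySite`, the four
  O_x→O_y bond vectors `ppVec` (nonzero, inside `[-1,1]²`).
* §2 **the fourteen coupling directions `emeryDirections`** (views over the cell): four Cu–O bond classes
  (`e₁` from Cu and from O_x, `e₂` from Cu and from O_y), four O–O classes (`ppVec k` from O_x), the site
  energies of Cu / O_x / O_y and the repulsions of Cu / O_x / O_y; their class constants
  `emeryConstants = (2,…,2,1,1,1)` with `|cellEnergy (D_a) ω| ≤ C_a` for EVERY state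
  (`abs_cellEnergy_emeryDirections_le`).
* §3 `emeryViews θ` (the model at `θ ∈ ℝ¹⁴`), the physical parameter line `emeryLine s : ℝ⁶ →ₗ ℝ¹⁴`
  (`(t_pd, t_pp, ε_d, ε_p, U_d, U_p)`, `s` the O–O sign pattern), the class
  `emeryStates ρ` (`2×2`-periodic, dummy density `0`, cell filling `ρ`; filling per `CuO₂` unit `= 4ρ`), the
  variational density **`emeryEnergyDensity θ ρ`**, and by instantiation: JOINT CONCAVITY in `θ` and along the
  physical line in the six parameters, BOX ⇒ WORD from box vertices, the JOINT LIPSCHITZ bound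
  `Σ_a C_a|Δθ_a|` (realised fillings), and the TRIAL-STATE CAP through any dummy-free periodic reference state.

Everything is PROVED; definitions with bodies (geometry labels, `emeryDirections`, `emeryConstants`, `emeryViews`,
`emeryLine`, `emeryStates`, `emeryEnergyDensity`), no named fact, no number of record, no `sorry`. HONEST SCOPE:
energy words only, at the variational level (periodic dummy-free states); norm class constants; the
identification with a thermodynamic limit of decorated tori and the kinematic (Fermi-sea) constants of the
decorated bands are not here; no producer (certificate format) exists yet for this object — this file is the
TYPED TARGET such producers would bind; nothing certifies a number about a material.

## Mathlib / tree search

REUSED: `sublatticeVectorHoppingViews`, `sublatticeOnSiteViews`, `abs_cellEnergy_sublatticeVectorHoppingViews_le`,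
`abs_cellEnergy_sublatticeOnSiteViews_le` (`SublatticeSelectiveInteractions`); `Cell`, `IsPeriodic`, `cellFilling`, `viewFamily`,
`InfVolFermionState.cellEnergy`, `infCellEnergyOn`, `concaveOn_infCellEnergyOn_viewFamily`, `le_infCellEnergyOn_viewFamily_of_mem_Icc`,
`abs_infCellEnergyOn_viewFamily_sub_le`, `infCellEnergyOn_viewFamily_le_trial` (`SuperlatticeCellEnergyFamilies`,
`PeriodicStatesCellAverage`); `unitVec_mem_thicken_one`, `mem_thicken_zero_iff`, `uvec_ne_zero`; Mathlib `ConcaveOn.comp_linearMap`.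
`lean search 'emery|Emery|threeBand|Lieb lattice|CuO2' --decl` (QuantumLattice): nothing (the tree's `Emery` mentions are
router prose in Summits/Ventures Downfold files).

## References

* V. J. Emery, Phys. Rev. Lett. 58 (1987) 2794 (the three-band `CuO₂` model: `t_pd`, `t_pp`, `Δ = ε_p − ε_d`, `U_d`,
  `U_p`) — cited through Pavarini et al. (2001) eq. (1) and §II for the one- and three-band dictionary.
  [cite: PavariniEtAl2001, eq. (1)]
* R. B. Israel, *Convexity in the Theory of Lattice Gases* (1979), Thm. I.3.4. [cite: Israel1979, Thm. I.3.4]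
* O. Bratteli, A. Kishimoto, D. W. Robinson, CMP 64 (1978) 41, Thm. 2. [cite: BratteliKishimotoRobinson1978, Thm. 2 (condition 2)]
* O. Bratteli, D. W. Robinson, *OAQSM 1* (1987), Prop. 2.3.11. [cite: BratteliRobinsonI1987, Prop. 2.3.11]
* R. T. Rockafellar, *Convex Analysis* (1970), Thm. 32.2. [cite: Rockafellar1970, Thm 32.2]
* H. Araki, H. Moriya, Rev. Math. Phys. 15 (2003) 93, §4.1. [cite: ArakiMoriya2003, §4.1]
-/

noncomputable section

namespace Literature.MathematicalPhysics.QuantumLattice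

open Matrix Finset HubbardWave0 Literature.Probability.LatticeModels ThermodynamicLimit
open Literature.Computation.Certificates
open scoped ComplexOrder BigOperators

/-! ### §1. The `2 × 2` decoration of `ℤ²`: Cu, O_x, O_y and an isolated dummy sublattice -/

section Geometry

/-- The `2 × 2` superlattice of `ℤ²` (periods `2, 2`): the Lieb-lattice decoration `CuO₂ + dummy`.
[cite: ArakiMoriya2003, §4.1] -/
def liebPeriods : Fin 2 → ℕ := ![1, 1]

/-- Coset label of the copper sites `(0,0) + 2ℤ²`. [cite: PavariniEtAl2001, eq. (1)] -/
def cuSite : Site 2 := 0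
/-- Coset label of the `O_x` sites `(1,0) + 2ℤ²` (oxygens on horizontal Cu–Cu links). [cite: PavariniEtAl2001, eq. (1)] -/
def oxSite : Site 2 := unitVec 0
/-- Coset label of the `O_y` sites `(0,1) + 2ℤ²`. [cite: PavariniEtAl2001, eq. (1)] -/
def oySite : Site 2 := unitVec 1
/-- Coset label of the DUMMY sites `(1,1) + 2ℤ²` (no orbital of the `CuO₂` plane lives there; no term of the
model touches them, and the variational class pins them empty). [cite: PavariniEtAl2001, eq. (1)] -/
def dummySite : Site 2 := unitVec 0 + unitVec 1

/-- The four O–O bond vectors from an `O_x` site to its `O_y` neighbours: `(1,1), (−1,1), (1,−1), (−1,−1)`.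
[cite: PavariniEtAl2001, eq. (1)] -/
def ppVec : Fin 4 → Site 2 := ![unitVec 0 + unitVec 1, -unitVec 0 + unitVec 1, unitVec 0 - unitVec 1, -unitVec 0 - unitVec 1]

/-- The O–O bond vectors are nonzero. [cite: PavariniEtAl2001, eq. (1)] -/
theorem ppVec_ne_zero (k : Fin 4) : ppVec k ≠ 0 := by
  intro h
  have h1 := congrFun h 1
  fin_cases k <;> simp [ppVec, unitVec] at h1

/-- The O–O bond vectors lie in `[-1,1]²`. [cite: FriedliVelenik2017, §3.2] -/
theorem ppVec_mem_thicken_one (k : Fin 4) : ppVec k ∈ thicken ({0} : Finset (Site 2)) 1 := by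
  rw [mem_thicken_zero_iff, Nat.floor_one]
  intro i
  fin_cases k <;> fin_cases i <;> simp [ppVec, unitVec]

end Geometry

/-! ### §2. The fourteen coupling directions of the decorated `CuO₂` model and their class constants -/

section Directions

/-- **The coupling directions of the three-band (Emery) `CuO₂` model by decoration of `ℤ²`**, as views over the
`2 × 2` cell: `0–3` the four Cu–O bond classes (`e₁`-bonds from Cu and from O_x, `e₂`-bonds from Cu and from
O_y) — unit amplitude each (`t_pd`); `4–7` the four O_x–O_y bond classes along `ppVec k` from O_x (`t_pp`, with
the model's sign pattern); `8` the Cu site energy (`ε_d`), `9, 10` the O_x, O_y site energies (`ε_p`); `11` the Cu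
repulsion (`U_d`), `12, 13` the O repulsions (`U_p`). No direction touches the dummy sublattice.
[cite: PavariniEtAl2001, eq. (1)] -/
def emeryDirections : Fin 14 → Cell liebPeriods → FermionInteraction 2 :=
  ![sublatticeVectorHoppingViews liebPeriods cuSite (unitVec 0) 1,
    sublatticeVectorHoppingViews liebPeriods oxSite (unitVec 0) 1,
    sublatticeVectorHoppingViews liebPeriods cuSite (unitVec 1) 1,
    sublatticeVectorHoppingViews liebPeriods oySite (unitVec 1) 1,
    sublatticeVectorHoppingViews liebPeriods oxSite (ppVec 0) 1,
    sublatticeVectorHoppingViews liebPeriods oxSite (ppVec 1) 1,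
    sublatticeVectorHoppingViews liebPeriods oxSite (ppVec 2) 1,
    sublatticeVectorHoppingViews liebPeriods oxSite (ppVec 3) 1,
    sublatticeOnSiteViews liebPeriods cuSite 1 0,
    sublatticeOnSiteViews liebPeriods oxSite 1 0,
    sublatticeOnSiteViews liebPeriods oySite 1 0,
    sublatticeOnSiteViews liebPeriods cuSite 0 1,
    sublatticeOnSiteViews liebPeriods oxSite 0 1,
    sublatticeOnSiteViews liebPeriods oySite 0 1]

/-- The class constants of the fourteen directions: `2` for each bond class and each site-energy direction, `1`
for each repulsion direction. [cite: BratteliRobinsonI1987, Prop. 2.3.11] -/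
def emeryConstants : Fin 14 → ℝ := ![2, 2, 2, 2, 2, 2, 2, 2, 2, 2, 2, 1, 1, 1]

/-- **Every direction's cell energy is bounded by its class constant, for every state** (range parameter `1`).
[cite: BratteliRobinsonI1987, Prop. 2.3.11] -/
theorem abs_cellEnergy_emeryDirections_le (ω : InfVolFermionState 2) (a : Fin 14) :
    |ω.cellEnergy (emeryDirections a) 1| ≤ emeryConstants a := by
  have h0 : (unitVec 0 : Site 2) ∈ thicken ({0} : Finset (Site 2)) 1 := unitVec_mem_thicken_one 0
  have h1 : (unitVec 1 : Site 2) ∈ thicken ({0} : Finset (Site 2)) 1 := unitVec_mem_thicken_one 1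
  fin_cases a
  · simpa [emeryDirections, emeryConstants] using
      abs_cellEnergy_sublatticeVectorHoppingViews_le liebPeriods cuSite (uvec_ne_zero 0) 1 h0 ω
  · simpa [emeryDirections, emeryConstants] using
      abs_cellEnergy_sublatticeVectorHoppingViews_le liebPeriods oxSite (uvec_ne_zero 0) 1 h0 ω
  · simpa [emeryDirections, emeryConstants] using
      abs_cellEnergy_sublatticeVectorHoppingViews_le liebPeriods cuSite (uvec_ne_zero 1) 1 h1 ω
  · simpa [emeryDirections, emeryConstants] using
      abs_cellEnergy_sublatticeVectorHoppingViews_le liebPeriods oySite (uvec_ne_zero 1) 1 h1 ω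
  · simpa [emeryDirections, emeryConstants] using
      abs_cellEnergy_sublatticeVectorHoppingViews_le liebPeriods oxSite (ppVec_ne_zero 0) 1 (ppVec_mem_thicken_one 0) ω
  · simpa [emeryDirections, emeryConstants] using
      abs_cellEnergy_sublatticeVectorHoppingViews_le liebPeriods oxSite (ppVec_ne_zero 1) 1 (ppVec_mem_thicken_one 1) ω
  · simpa [emeryDirections, emeryConstants] using
      abs_cellEnergy_sublatticeVectorHoppingViews_le liebPeriods oxSite (ppVec_ne_zero 2) 1 (ppVec_mem_thicken_one 2) ω
  · simpa [emeryDirections, emeryConstants] using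
      abs_cellEnergy_sublatticeVectorHoppingViews_le liebPeriods oxSite (ppVec_ne_zero 3) 1 (ppVec_mem_thicken_one 3) ω
  · simpa [emeryDirections, emeryConstants] using abs_cellEnergy_sublatticeOnSiteViews_le liebPeriods cuSite 1 0 1 ω
  · simpa [emeryDirections, emeryConstants] using abs_cellEnergy_sublatticeOnSiteViews_le liebPeriods oxSite 1 0 1 ω
  · simpa [emeryDirections, emeryConstants] using abs_cellEnergy_sublatticeOnSiteViews_le liebPeriods oySite 1 0 1 ω
  · simpa [emeryDirections, emeryConstants] using abs_cellEnergy_sublatticeOnSiteViews_le liebPeriods cuSite 0 1 1 ω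
  · simpa [emeryDirections, emeryConstants] using abs_cellEnergy_sublatticeOnSiteViews_le liebPeriods oxSite 0 1 1 ω
  · simpa [emeryDirections, emeryConstants] using abs_cellEnergy_sublatticeOnSiteViews_le liebPeriods oySite 0 1 1 ω

end Directions

/-! ### §3. The decorated three-band model, its variational class and energy density -/

section Model

/-- **The views of the decorated `CuO₂` (Emery) model at the coupling vector `θ ∈ ℝ¹⁴`** (base: no term).
[cite: PavariniEtAl2001, eq. (1)] -/
def emeryViews (θ : Fin 14 → ℝ) : Cell liebPeriods → FermionInteraction 2 :=
  viewFamily (fun _ => hubbardFermionInteraction 2 0 0) emeryDirections θ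

/-- **The physical parameter line** `(t_pd, t_pp, ε_d, ε_p, U_d, U_p) ↦ θ ∈ ℝ¹⁴` for a given O–O sign pattern
`s` (the four Cu–O classes share `t_pd`, the four O–O classes carry `s_k · t_pp`, the two oxygen sublattices
share `ε_p` and `U_p`); a linear map, so joint concavity in `θ` descends to the six physical parameters.
[cite: PavariniEtAl2001, eq. (1)] -/
def emeryLine (s : Fin 4 → ℝ) : (Fin 6 → ℝ) →ₗ[ℝ] (Fin 14 → ℝ) where
  toFun p := ![p 0, p 0, p 0, p 0, s 0 * p 1, s 1 * p 1, s 2 * p 1, s 3 * p 1, p 2, p 3, p 3, p 4, p 5, p 5]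
  map_add' p p' := by
    ext a; fin_cases a <;> simp <;> ring
  map_smul' c p := by
    ext a; fin_cases a <;> simp <;> ring

/-- **The variational class of the decorated model at cell filling `ρ`**: `2×2`-periodic states, EMPTY on the
dummy sublattice (`ρ(ω ∘ τ_{(1,1)}) = 0`), with cell filling `ρ` (so the filling of the physical `CuO₂` unit is
`4ρ`). [cite: ArakiMoriya2003, §4.1 Def. 4.5] -/
def emeryStates (ρ : ℝ) : Set (InfVolFermionState 2) :=
  {ω | ω.IsPeriodic liebPeriods ∧ (ω.shift dummySite).density = 0 ∧ ω.cellFilling liebPeriods = ρ}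

/-- **The variational ground-state energy density of the decorated three-band model** at coupling vector `θ`
and cell filling `ρ` (per site of `ℤ²`; times `4` = per `CuO₂` unit). [cite: BratteliKishimotoRobinson1978, Thm. 2 (condition 2)] -/
def emeryEnergyDensity (θ : Fin 14 → ℝ) (ρ : ℝ) : ℝ :=
  infCellEnergyOn (emeryStates ρ) (emeryViews θ) 1

/-- **JOINT CONCAVITY of the three-band energy density in all fourteen couplings.** [cite: Israel1979, Thm. I.3.4] -/
theorem concaveOn_emeryEnergyDensity (ρ : ℝ) : ConcaveOn ℝ Set.univ fun θ : Fin 14 → ℝ => emeryEnergyDensity θ ρ :=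
  concaveOn_infCellEnergyOn_viewFamily _ _ _ 1

/-- **Joint concavity in the six physical parameters `(t_pd, t_pp, ε_d, ε_p, U_d, U_p)`** (any sign pattern of
the O–O hoppings): chords between certified anchors are floors, tangent planes are caps — exactly the box
calculus of the one-band programme. [cite: Israel1979, Thm. I.3.4] -/
theorem concaveOn_emeryEnergyDensity_line (s : Fin 4 → ℝ) (ρ : ℝ) :
    ConcaveOn ℝ Set.univ fun p : Fin 6 → ℝ => emeryEnergyDensity (emeryLine s p) ρ := by
  have h := (concaveOn_emeryEnergyDensity ρ).comp_linearMap (emeryLine s)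
  refine ⟨convex_univ, fun x _ y _ a b ha hb hab => ?_⟩
  have h' := h.2 (Set.mem_univ x) (Set.mem_univ y) ha hb hab
  simpa using h'

/-- **BOX ⇒ WORD for the three-band model**: a floor certified at the `2¹⁴` vertices of a coupling box (or, along
the physical line, at the vertices of a six-parameter box mapped through `emeryLine`) holds inside the box.
[cite: Rockafellar1970, Thm 32.2] -/
theorem le_emeryEnergyDensity_of_mem_Icc (ρ : ℝ) (lo hi : Fin 14 → ℝ) {m : ℝ}
    (hm : ∀ v ∈ Fintype.piFinset (fun a => ({lo a, hi a} : Finset ℝ)), m ≤ emeryEnergyDensity v ρ)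
    {θ : Fin 14 → ℝ} (hθ : θ ∈ Set.Icc lo hi) : m ≤ emeryEnergyDensity θ ρ :=
  le_infCellEnergyOn_viewFamily_of_mem_Icc _ _ _ 1 lo hi hm hθ

/-- **JOINT LIPSCHITZ BOUND** (realised filling, i.e. non-empty class): `|e(θ, ρ) − e(θ', ρ)| ≤ Σ_a C_a|θ_a − θ'_a|`
with `C = (2,…,2, 1,1,1)` — bond classes and site energies cost `2` per unit amplitude, repulsions `1`.
[cite: Israel1979, Thm. I.3.4] -/
theorem abs_emeryEnergyDensity_sub_le {ρ : ℝ} (hne : (emeryStates ρ).Nonempty) (θ θ' : Fin 14 → ℝ) :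
    |emeryEnergyDensity θ ρ - emeryEnergyDensity θ' ρ| ≤ ∑ a, emeryConstants a * |θ a - θ' a| :=
  abs_infCellEnergyOn_viewFamily_sub_le _ _ 1 hne (fun ω _ a => abs_cellEnergy_emeryDirections_le ω a) θ θ'

/-- **TRIAL-STATE CAP**: any dummy-free `2×2`-periodic state `ω₀` of cell filling `ρ` (e.g. a product or
Hartree–Fock-type reference of the decorated lattice) caps the three-band energy density at EVERY coupling vector
through its own cell-averaged conjugate densities: `e(θ, ρ) ≤ e_{M(θ₀)}(ω₀) + Σ_a (θ_a − θ₀_a) e_{D_a}(ω₀)`.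
[cite: KomaTasaki1994, §1] -/
theorem emeryEnergyDensity_le_trial {ρ : ℝ} {ω₀ : InfVolFermionState 2} (hω₀ : ω₀ ∈ emeryStates ρ)
    (θ₀ θ : Fin 14 → ℝ) :
    emeryEnergyDensity θ ρ ≤
      ω₀.cellEnergy (emeryViews θ₀) 1 + ∑ a, (θ a - θ₀ a) * ω₀.cellEnergy (emeryDirections a) 1 :=
  infCellEnergyOn_viewFamily_le_trial _ _ 1 hω₀ θ₀ θ

end Model

end Literature.MathematicalPhysics.QuantumLattice

end
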